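import Literature.Analysis.FluidPDE.ParabolicRescale
import Literature.Analysis.FluidPDE.KatoLocalBoundedPicard
import HarnessLib

/-!
# KNSS 2009, Prop. 4.1: the Picard iteration in weighted norms (from the two estimates)

Analysis/FluidPDE file on the discharge path of the named fact
`Literature.Analysis.FluidPDE.knss2009_local_smoothing` (`NSBoundedMildSmoothing.lean`;
Koch–Nadirashvili–Seregin–Šverák, Acta Math. 203 (2009) = arXiv:0709.3599, §4 p. 8, Prop. 4.1).
The printed proof of Prop. 4.1 ("This can be proved in the same way as … [GigaSawada], [DongDu],
[GermainPavlovicStaffilani] … The key is an estimate of `B` with the same form as (4.4) but in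
spaces with norms given by the expression on the left-hand side of (4.5)") is a fixed point of
`u = U + B(u,u)` ((4.3)) in the weighted norms `‖t^{k/2+l}∇ᵏₓ∂ₜˡu‖_∞`. This file runs that
iteration **given the two estimates as hypotheses**, stated in the isotropic rescaled form of
`ParabolicRescale.lean` (`IsWeightedSmooth`, `HasWeightedBound`):

* `WeightedHeatEstimate E` — the free term `U(t) = e^{νtΔ}a` of bounded measurable data is
  weighted-smooth with bounds of order `≤ N` by `K_N ‖a‖_∞` (KNSS 2009, Remark 4.2: "the
  local-in-time smoothing properties … are the same as those of the heat equation");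
* `WeightedBilinearEstimate E` — the Duhamel term `B^ν_0(v,w)` of weighted-smooth fields is
  weighted-smooth, with bounds of order `≤ N` by `A_N √(T/ν) Cv Cw` on the slab `(0, T)` (the
  weighted form of (4.4), KNSS 2009, §4 p. 8);

and runs the iteration `u₀ = U`, `u_{m+1} = U - B(u_m,u_m)` (`oseenPicardMap`, `oseenPicardSeq`)
**in the weighted classes**, proving the two facts that make it converge:

* `oseenPicardSeq_invariant`: with `K' ≥ K_N` and a slab short enough that
  `A_N √(T/ν) (2K'M)² ≤ K'M`, every iterate is weighted-smooth with bounds `2K'M` of orders `≤ N`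
  (the ball of radius `2‖U‖`, as in Lemarié-Rieusset 2016, Thm. 5.1);
* `oseenPicardSeq_sub_bound`: under `A_N √(T/ν) (2K'M) ≤ 1/4` the differences
  `u_{m+1} - u_m = -(B(u_m - u_{m-1}, u_m) + B(u_{m-1}, u_m - u_{m-1}))`
  (`oseenPicardSeq_succ_sub_succ`, bilinearity of `B` on bounded measurable fields,
  `oseenDuhamel_self_sub_self`) have weighted bounds `K'M / 2^m` of orders `≤ N`.

The limit (a pointwise solution of (4.3) whose rescalings are `C^N` with the bounds `2K'M`) is
taken in the sequel `NSBoundedMildWeightedLimit.lean`; the two estimates are discharged in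
`NSBoundedMildWeightedHeat.lean` and the bilinear files; the mixed-derivative form (4.5) of
`knss2009_local_smoothing` is extracted in `NSBoundedMildLocalOfEstimates.lean`.

## References

* G. Koch, N. Nadirashvili, G. Seregin, V. Šverák, *Liouville theorems for the Navier–Stokes
  equations and applications*, Acta Math. 203 (2009) = arXiv:0709.3599, §4 p. 8: (4.3)–(4.5),
  Prop. 4.1, Remark 4.2. [KochNadirashviliSereginSverak2009]
* Y. Giga, K. Inui, S. Matsui, Quad. Mat. 4 (1999) (the weighted iteration for `L^∞` data).
* P. G. Lemarié-Rieusset, *The Navier–Stokes problem in the 21st century* (2016), Thm. 5.1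
  (Picard contraction for `u = u₀ + B(u,u)`). [LemarieRieusset2016]
-/

noncomputable section

open MeasureTheory Set Function Filter Metric Real
open _root_.Topology
open scoped ENNReal NNReal ContDiff

namespace Literature.Analysis.FluidPDE

open UnboundedOperators (heatExtension)

variable (E : Type*) [NormedAddCommGroup E] [InnerProductSpace ℝ E] [FiniteDimensional ℝ E]
  [MeasurableSpace E] [BorelSpace E]

/-! ### The two estimates -/

/-- **(H) The weighted heat estimate** (KNSS 2009, Remark 4.2; Giga–Inui–Matsui 1999): for
every order `N` there is `K ≥ 0` such that for `ν > 0`, `T > 0`, `M ≥ 0` and every measurable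
datum `a` with `‖a(x)‖ ≤ M` for all `x`, the free evolution `U(t, x) = e^{νtΔ}a(x)` is
weighted-smooth on `(0, T) × E` (`IsWeightedSmooth`) with scale-invariant bounds of orders `≤ N`
by `K M` (`HasWeightedBound`): the isotropic form of `‖t^{k/2+l}∇ᵏₓ∂ₜˡ e^{νtΔ}a‖_∞ ≤ C‖a‖_∞`.
[cite: KochNadirashviliSereginSverak2009, Remark 4.2 (arXiv:0709.3599 p. 8)] -/
def WeightedHeatEstimate : Prop :=
  ∀ N : ℕ, ∃ K : ℝ, 0 ≤ K ∧ ∀ ⦃ν T M : ℝ⦄, 0 < ν → 0 < T → 0 ≤ M → ∀ ⦃a : E → E⦄,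
    AEStronglyMeasurable a volume → (∀ x, ‖a x‖ ≤ M) →
    IsWeightedSmooth ν T (fun t x => heatExtension a (ν * t) x) ∧
    HasWeightedBound ν T N (fun t x => heatExtension a (ν * t) x) (K * M)

/-- **(B) The weighted bilinear estimate** (KNSS 2009, §4 p. 8: "The key is an estimate of `B`
with the same form as [`‖B(u,v)‖ ≤ C√T‖u‖‖v‖`, (4.4)] but in spaces with norms given by the
expression on the left-hand side of (4.5)"): for every order `N` there is `A ≥ 0` such that for
`ν > 0`, `T > 0` and weighted-smooth fields `v`, `w` on `(0, T) × E`, the Duhamel term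
`B^ν_0(v, w)` is weighted-smooth there, and scale-invariant bounds `Cv`, `Cw` of orders `≤ N` for
`v`, `w` give the bound `A √(T/ν) Cv Cw` of orders `≤ N` for `B^ν_0(v, w)`.
[cite: KochNadirashviliSereginSverak2009, §4 (4.4)–(4.5) and Prop. 4.1 (arXiv:0709.3599 p. 8)] -/
def WeightedBilinearEstimate : Prop :=
  ∀ N : ℕ, ∃ A : ℝ, 0 ≤ A ∧ ∀ ⦃ν T : ℝ⦄, 0 < ν → 0 < T → ∀ ⦃v w : ℝ → E → E⦄,
    IsWeightedSmooth ν T v → IsWeightedSmooth ν T w →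
    IsWeightedSmooth ν T (oseenDuhamel ν 0 v w) ∧
    ∀ ⦃Cv Cw : ℝ⦄, HasWeightedBound ν T N v Cv → HasWeightedBound ν T N w Cw →
      HasWeightedBound ν T N (oseenDuhamel ν 0 v w) (A * Real.sqrt (T / ν) * Cv * Cw)

variable {E}

/-! ### Weighted-smooth fields as bounded measurable fields on the slab -/

section Slab

variable {ν T : ℝ}

/-- A weighted-smooth field is a.e. strongly measurable on the slab. [folklore] -/
theorem IsWeightedSmooth.aestronglyMeasurable {w : ℝ → E → E} (h : IsWeightedSmooth ν T w) :
    AEStronglyMeasurable (uncurry w) ((volume : Measure (ℝ × E)).restrict (Ioo 0 T ×ˢ univ)) :=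
  h.continuousOn.aestronglyMeasurable (measurableSet_Ioo.prod MeasurableSet.univ)

omit [FiniteDimensional ℝ E] [MeasurableSpace E] [BorelSpace E] in
/-- The order-zero weighted bound as a bound on the slab, in the form consumed by the Duhamel
lemmas. [folklore] -/
theorem HasWeightedBound.norm_le_slab {N : ℕ} {w : ℝ → E → E} {C : ℝ} (h : HasWeightedBound ν T N w C)
    (hν : 0 < ν) : ∀ τ ∈ Ioo 0 T, ∀ y, ‖w τ y‖ ≤ C :=
  fun _ hτ y => h.norm_le hν hτ y

omit [FiniteDimensional ℝ E] [MeasurableSpace E] [BorelSpace E] in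
/-- **Fields agreeing on the slab have the same weighted bounds.** [folklore] -/
theorem HasWeightedBound.congr_slab {N : ℕ} {v w : ℝ → E → E} {C : ℝ} (h : HasWeightedBound ν T N v C)
    (hvw : ∀ t ∈ Ioo 0 T, ∀ x, v t x = w t x) : HasWeightedBound ν T N w C := by
  intro t₀ ht₀ m hm ξ
  have heq : parabolicRescale ν t₀ v =ᶠ[𝓝 ((1 : ℝ), ξ)] parabolicRescale ν t₀ w := by
    have hopen : IsOpen (Ioo 0 (T / t₀) ×ˢ (univ : Set E)) := isOpen_Ioo.prod isOpen_univ
    have hmem : ((1 : ℝ), ξ) ∈ Ioo 0 (T / t₀) ×ˢ (univ : Set E) :=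
      mk_mem_prod ⟨one_pos, by rw [lt_div_iff₀ ht₀.1]; linarith [ht₀.2]⟩ (mem_univ _)
    filter_upwards [hopen.mem_nhds hmem] with p hp
    obtain ⟨hp1, -⟩ := mem_prod.1 hp
    simp only [parabolicRescale_apply]
    refine hvw _ ⟨mul_pos ht₀.1 hp1.1, ?_⟩ _
    calc t₀ * p.1 < t₀ * (T / t₀) := mul_lt_mul_of_pos_left hp1.2 ht₀.1
      _ = T := mul_div_cancel₀ T ht₀.1.ne'
  rw [← (heq.iteratedFDeriv ℝ m).eq_of_nhds]
  exact h t₀ ht₀ m hm ξ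

omit [FiniteDimensional ℝ E] [MeasurableSpace E] [BorelSpace E] in
/-- **Fields agreeing on the slab are weighted-smooth together.** [folklore] -/
theorem IsWeightedSmooth.congr_slab {v w : ℝ → E → E} (h : IsWeightedSmooth ν T v)
    (hvw : ∀ t ∈ Ioo 0 T, ∀ x, v t x = w t x) : IsWeightedSmooth ν T w := by
  refine ⟨h.contDiffOn.congr fun p hp => ?_, fun m => ?_⟩
  · obtain ⟨hp1, -⟩ := mem_prod.1 hp
    exact (hvw p.1 hp1 p.2).symm
  · obtain ⟨C, -, hC⟩ := h.exists_hasWeightedBound m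
    exact ⟨C, fun t₀ ht₀ ξ => (hC.congr_slab hvw) t₀ ht₀ m le_rfl ξ⟩

end Slab

/-! ### The iteration -/

section Picard

variable {ν T M : ℝ} {a : E → E}

/-- **The Picard map** `Φ(u) = U - B^ν_0(u, u)`, `U(t) = e^{νtΔ}a` (KNSS 2009, (4.3)).
[cite: KochNadirashviliSereginSverak2009, (4.3) (arXiv:0709.3599 p. 8)] -/
def oseenPicardMap (ν : ℝ) (a : E → E) (u : ℝ → E → E) : ℝ → E → E :=
  fun t x => heatExtension a (ν * t) x - oseenDuhamel ν 0 u u t x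

/-- **The Picard iterates** `u₀ = U`, `u_{m+1} = Φ(u_m)` (KNSS 2009, (4.3); Lemarié-Rieusset
2016, Thm. 5.1). [cite: KochNadirashviliSereginSverak2009, (4.3) (arXiv:0709.3599 p. 8)] -/
def oseenPicardSeq (ν : ℝ) (a : E → E) : ℕ → ℝ → E → E
  | 0 => fun t x => heatExtension a (ν * t) x
  | m + 1 => oseenPicardMap ν a (oseenPicardSeq ν a m)

/-- The successor iterate, unfolded. [folklore] -/
theorem oseenPicardSeq_succ_apply (ν : ℝ) (a : E → E) (m : ℕ) (t : ℝ) (x : E) :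
    oseenPicardSeq ν a (m + 1) t x =
      heatExtension a (ν * t) x - oseenDuhamel ν 0 (oseenPicardSeq ν a m) (oseenPicardSeq ν a m) t x := rfl

/-- The successor iterate as a difference of fields. [folklore] -/
theorem oseenPicardSeq_succ (ν : ℝ) (a : E → E) (m : ℕ) :
    oseenPicardSeq ν a (m + 1) =
      (fun t x => heatExtension a (ν * t) x) - oseenDuhamel ν 0 (oseenPicardSeq ν a m) (oseenPicardSeq ν a m) := rfl

/-- **Invariants of the iterates**: under (H), (B) with constants `K ≤ K'`, `A` for the order
`N`, on a slab short enough that `A √(T/ν) (2K'M)² ≤ K'M`, every iterate is weighted-smooth with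
bounds `2K'M` of orders `≤ N` (KNSS 2009, §4: the fixed point lives in the ball of radius
`2‖U‖`). [folklore] -/
theorem oseenPicardSeq_invariant {N : ℕ} {K A K' : ℝ}
    (hH : ∀ ⦃ν T M : ℝ⦄, 0 < ν → 0 < T → 0 ≤ M → ∀ ⦃a : E → E⦄,
      AEStronglyMeasurable a volume → (∀ x, ‖a x‖ ≤ M) →
      IsWeightedSmooth ν T (fun t x => heatExtension a (ν * t) x) ∧
      HasWeightedBound ν T N (fun t x => heatExtension a (ν * t) x) (K * M))
    (hB : ∀ ⦃ν T : ℝ⦄, 0 < ν → 0 < T → ∀ ⦃v w : ℝ → E → E⦄,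
      IsWeightedSmooth ν T v → IsWeightedSmooth ν T w →
      IsWeightedSmooth ν T (oseenDuhamel ν 0 v w) ∧
      ∀ ⦃Cv Cw : ℝ⦄, HasWeightedBound ν T N v Cv → HasWeightedBound ν T N w Cw →
        HasWeightedBound ν T N (oseenDuhamel ν 0 v w) (A * Real.sqrt (T / ν) * Cv * Cw))
    (hν : 0 < ν) (hT : 0 < T) (hM : 0 ≤ M) (ham : AEStronglyMeasurable a volume)
    (haM : ∀ x, ‖a x‖ ≤ M) (hKK' : K ≤ K')
    (hsmall : A * Real.sqrt (T / ν) * (2 * K' * M) * (2 * K' * M) ≤ K' * M) (m : ℕ) :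
    IsWeightedSmooth ν T (oseenPicardSeq ν a m) ∧ HasWeightedBound ν T N (oseenPicardSeq ν a m) (2 * K' * M) := by
  obtain ⟨hUs, hUb⟩ := hH hν hT hM ham haM
  have hK'M : K * M ≤ K' * M := mul_le_mul_of_nonneg_right hKK' hM
  have hK'0 : 0 ≤ K' * M := by
    have : 0 ≤ K * M := by
      haveI : Nonempty E := ⟨0⟩
      exact hUb.nonneg hT
    exact this.trans hK'M
  induction m with
  | zero =>
    refine ⟨hUs, ?_⟩
    exact (hUb.mono hK'M).mono (by linarith)
  | succ m ih =>
    obtain ⟨hs, hb⟩ := ih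
    obtain ⟨hBs, hBb⟩ := hB hν hT hs hs
    have hBb' := hBb hb hb
    rw [oseenPicardSeq_succ]
    refine ⟨hUs.sub hBs, ?_⟩
    refine ((hUb.mono hK'M).sub hBb' hUs hBs).mono ?_
    linarith

/-- **The difference identity on the slab**: for bounded measurable iterates,
`u_{m+2} - u_{m+1} = -(B(u_{m+1} - u_m, u_{m+1}) + B(u_m, u_{m+1} - u_m))` pointwise on
`(0, T) × E` (bilinearity of the Duhamel term, `oseenDuhamel_self_sub_self`).
[cite: LemarieRieusset2016, Thm. 5.1 (proof, PDF p. 104)] -/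
theorem oseenPicardSeq_succ_sub_succ (hν : 0 < ν) {m : ℕ} {C : ℝ}
    (hs₀ : IsWeightedSmooth ν T (oseenPicardSeq ν a m)) (hs₁ : IsWeightedSmooth ν T (oseenPicardSeq ν a (m + 1)))
    (hb₀ : HasWeightedBound ν T 0 (oseenPicardSeq ν a m) C)
    (hb₁ : HasWeightedBound ν T 0 (oseenPicardSeq ν a (m + 1)) C) {t : ℝ} (ht : t ∈ Ioo 0 T) (x : E) :
    (oseenPicardSeq ν a (m + 2) - oseenPicardSeq ν a (m + 1)) t x =
      -(oseenDuhamel ν 0 (oseenPicardSeq ν a (m + 1) - oseenPicardSeq ν a m) (oseenPicardSeq ν a (m + 1)) t x +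
        oseenDuhamel ν 0 (oseenPicardSeq ν a m) (oseenPicardSeq ν a (m + 1) - oseenPicardSeq ν a m) t x) := by
  have h := oseenDuhamel_self_sub_self (s := 0) (T := T) hν hs₁.aestronglyMeasurable
    hs₀.aestronglyMeasurable (hb₁.norm_le_slab hν) (hb₀.norm_le_slab hν) ht.1 ht.2.le x
  simp only [Pi.sub_apply, oseenPicardSeq_succ_apply]
  have h' : oseenDuhamel ν 0 (oseenPicardSeq ν a (m + 1)) (oseenPicardSeq ν a (m + 1)) t x -
      oseenDuhamel ν 0 (oseenPicardSeq ν a m) (oseenPicardSeq ν a m) t x =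
      oseenDuhamel ν 0 (oseenPicardSeq ν a (m + 1) - oseenPicardSeq ν a m) (oseenPicardSeq ν a (m + 1)) t x +
        oseenDuhamel ν 0 (oseenPicardSeq ν a m) (oseenPicardSeq ν a (m + 1) - oseenPicardSeq ν a m) t x := by
    rw [h]; rfl
  rw [← h']
  abel

/-- **Contraction of the differences**: with the invariants of `oseenPicardSeq_invariant` and the
smallness `A √(T/ν) (2K'M) ≤ 1/4`, the differences `u_{m+1} - u_m` have weighted bounds
`K'M / 2^m` of orders `≤ N`. [folklore] -/
theorem oseenPicardSeq_sub_bound {N : ℕ} {K A K' : ℝ}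
    (hH : ∀ ⦃ν T M : ℝ⦄, 0 < ν → 0 < T → 0 ≤ M → ∀ ⦃a : E → E⦄,
      AEStronglyMeasurable a volume → (∀ x, ‖a x‖ ≤ M) →
      IsWeightedSmooth ν T (fun t x => heatExtension a (ν * t) x) ∧
      HasWeightedBound ν T N (fun t x => heatExtension a (ν * t) x) (K * M))
    (hB : ∀ ⦃ν T : ℝ⦄, 0 < ν → 0 < T → ∀ ⦃v w : ℝ → E → E⦄,
      IsWeightedSmooth ν T v → IsWeightedSmooth ν T w →
      IsWeightedSmooth ν T (oseenDuhamel ν 0 v w) ∧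
      ∀ ⦃Cv Cw : ℝ⦄, HasWeightedBound ν T N v Cv → HasWeightedBound ν T N w Cw →
        HasWeightedBound ν T N (oseenDuhamel ν 0 v w) (A * Real.sqrt (T / ν) * Cv * Cw))
    (hν : 0 < ν) (hT : 0 < T) (hM : 0 ≤ M) (ham : AEStronglyMeasurable a volume)
    (haM : ∀ x, ‖a x‖ ≤ M) (hKK' : K ≤ K')
    (hsmall : A * Real.sqrt (T / ν) * (2 * K' * M) ≤ 1 / 4) (m : ℕ) :
    HasWeightedBound ν T N (oseenPicardSeq ν a (m + 1) - oseenPicardSeq ν a m) (K' * M / 2 ^ m) := by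
  have hK'M : K * M ≤ K' * M := mul_le_mul_of_nonneg_right hKK' hM
  have hK'0 : 0 ≤ K' * M := by
    obtain ⟨-, hUb⟩ := hH hν hT hM ham haM
    haveI : Nonempty E := ⟨0⟩
    exact (hUb.nonneg hT).trans hK'M
  have hsmall' : A * Real.sqrt (T / ν) * (2 * K' * M) * (2 * K' * M) ≤ K' * M := by
    have h2 : 0 ≤ 2 * K' * M := by linarith
    calc A * Real.sqrt (T / ν) * (2 * K' * M) * (2 * K' * M) ≤ 1 / 4 * (2 * K' * M) :=
          mul_le_mul_of_nonneg_right hsmall h2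
      _ = K' * M / 2 := by ring
      _ ≤ K' * M := by linarith
  have hinv := oseenPicardSeq_invariant hH hB hν hT hM ham haM hKK' hsmall'
  induction m with
  | zero =>
    -- `u₁ - u₀ = -B(U, U)`
    obtain ⟨hUs, hUb⟩ := hH hν hT hM ham haM
    obtain ⟨hBs, hBb⟩ := hB hν hT hUs hUs
    have hb := hBb (hUb.mono hK'M) (hUb.mono hK'M)
    have heq : ∀ t ∈ Ioo 0 T, ∀ x,
        (-oseenDuhamel ν 0 (oseenPicardSeq ν a 0) (oseenPicardSeq ν a 0)) t x =
          (oseenPicardSeq ν a 1 - oseenPicardSeq ν a 0) t x := by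
      intro t _ x
      simp only [Pi.neg_apply, Pi.sub_apply, oseenPicardSeq_succ_apply]
      change -oseenDuhamel ν 0 (oseenPicardSeq ν a 0) (oseenPicardSeq ν a 0) t x =
        heatExtension a (ν * t) x - oseenDuhamel ν 0 (oseenPicardSeq ν a 0) (oseenPicardSeq ν a 0) t x -
          heatExtension a (ν * t) x
      abel
    refine (hb.neg.congr_slab heq).mono ?_
    rw [pow_zero, div_one]
    have h1 : A * Real.sqrt (T / ν) * (K' * M) * (K' * M) ≤ 1 / 4 * (K' * M) := by
      have : A * Real.sqrt (T / ν) * (K' * M) * (K' * M) =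
          (A * Real.sqrt (T / ν) * (2 * K' * M)) * (K' * M) / 2 := by ring
      rw [this]
      have := mul_le_mul_of_nonneg_right hsmall hK'0
      linarith
    linarith
  | succ m ih =>
    obtain ⟨hs₀, hb₀⟩ := hinv m
    obtain ⟨hs₁, hb₁⟩ := hinv (m + 1)
    have hds : IsWeightedSmooth ν T (oseenPicardSeq ν a (m + 1) - oseenPicardSeq ν a m) := hs₁.sub hs₀
    obtain ⟨hB₁s, hB₁b⟩ := hB hν hT hds hs₁
    obtain ⟨hB₂s, hB₂b⟩ := hB hν hT hs₀ hds
    have h₁ := hB₁b ih hb₁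
    have h₂ := hB₂b hb₀ ih
    have hsum := (h₁.sub h₂.neg hB₁s hB₂s.neg)
    -- the identity on the slab
    have heq : ∀ t ∈ Ioo 0 T, ∀ x,
        (oseenDuhamel ν 0 (oseenPicardSeq ν a (m + 1) - oseenPicardSeq ν a m) (oseenPicardSeq ν a (m + 1)) -
          -oseenDuhamel ν 0 (oseenPicardSeq ν a m) (oseenPicardSeq ν a (m + 1) - oseenPicardSeq ν a m)) t x =
        (-(oseenPicardSeq ν a (m + 2) - oseenPicardSeq ν a (m + 1))) t x := by
      intro t ht x
      have h := oseenPicardSeq_succ_sub_succ hν hs₀ hs₁ (hb₀.of_le (Nat.zero_le _))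
        (hb₁.of_le (Nat.zero_le _)) ht x
      simp only [Pi.sub_apply, Pi.neg_apply] at h ⊢
      rw [h]
      abel
    have hfin := (hsum.congr_slab heq).neg
    rw [neg_neg] at hfin
    refine hfin.mono ?_
    -- arithmetic: `2 · A√(T/ν) · (K'M/2^m) · (2K'M) ≤ K'M/2^(m+1)`
    have hp : 0 < (2 : ℝ) ^ m := pow_pos two_pos m
    have hx : 0 ≤ K' * M / 2 ^ m := div_nonneg hK'0 hp.le
    have key : A * Real.sqrt (T / ν) * (K' * M / 2 ^ m) * (2 * K' * M) ≤ 1 / 4 * (K' * M / 2 ^ m) := by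
      have : A * Real.sqrt (T / ν) * (K' * M / 2 ^ m) * (2 * K' * M) =
          (A * Real.sqrt (T / ν) * (2 * K' * M)) * (K' * M / 2 ^ m) := by ring
      rw [this]
      exact mul_le_mul_of_nonneg_right hsmall hx
    have key' : A * Real.sqrt (T / ν) * (2 * K' * M) * (K' * M / 2 ^ m) ≤ 1 / 4 * (K' * M / 2 ^ m) :=
      mul_le_mul_of_nonneg_right hsmall hx
    rw [pow_succ]
    rw [div_mul_eq_div_div] at *
    linarith

end Picard

end Literature.Analysis.FluidPDE

end
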